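import Mathlib
import Summits.ABC.ABC.Theses.IneffectiveSubspace
import Literature.NumberTheory.DiophantineGeometry.AbcWave0
import Literature.NumberTheory.DiophantineGeometry.StewartPadicOrder

/-!
# Sketch — crux-ideate stmt-ABC-1648 (`PrimePowerRadical`), ideator 3, round 1

First-lemma signatures and THREE full proofs (`LTE.wieferichSupport`; `Parity.oddLevel_infinite` and
`Parity.infinite_nonWieferich_of_finite_levelThree`, both modulo the hypothesis `Ljunggren1943`) for the idea cards
* `Ideas/lte-wieferich-transfer.md`      (namespaces `LTE`, `Split` — the transfer and its giant/small refinement)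
* `Ideas/ljunggren-parity-level-dial.md` (namespace `Parity` — wall theorems, parity breach, level dial)
Nothing here is a route item. `PrimePowerRadicalAt q` is the crux specialised to one prime `q`
(the crux is `∀ q, q.Prime → PrimePowerRadicalAt q` verbatim).
-/

namespace Summit.ABC.ABC.Cruxes.PrimePowerRadical.Sketch

open scoped BigOperators
open Finset Literature.NumberTheory.DiophantineGeometry

/-- The crux at one prime base `q` (verbatim body of `IneffectiveSubspace.PrimePowerRadical`). -/
def PrimePowerRadicalAt (q : ℕ) : Prop :=
  ∀ ε : ℝ, 0 < ε → ∃ C : ℝ, 0 < C ∧ ∀ k : ℕ, 1 ≤ k →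
    ((q ^ k : ℕ) : ℝ) < C * ((rad 1 (q ^ k - 1) (q ^ k) : ℕ) : ℝ) ^ (1 + ε)

theorem primePowerRadical_iff :
    Summit.ABC.ABC.Theses.IneffectiveSubspace.PrimePowerRadical ↔
      ∀ q : ℕ, q.Prime → PrimePowerRadicalAt q :=
  Iff.rfl

/-! ## Card `lte-wieferich-transfer` -/
namespace LTE

/-- **First lemma (WieferichSupport) — PROVED.** A prime `r ≠ 2` not dividing `k` whose square
divides `q ^ k - 1` is a base-`q` Wieferich prime. This is the lifting-the-exponent inequality
`ord_r(qᵏ − 1) ≤ ord_r(q^{r−1} − 1) + ord_r(k)` (tree: `Dioph.padicValNat_pow_sub_pow_le_fermat`,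
Stewart 2013 (66)) read backwards: the powerful part of `qᵏ − 1` away from the primes of `k` is
supported on Wieferich primes. -/
theorem wieferichSupport {q r k : ℕ} (hq : q.Prime) (hr : r.Prime) (hr2 : r ≠ 2)
    (hrk : ¬ r ∣ k) (hdvd : r ^ 2 ∣ q ^ k - 1) : IsWieferich q r := by
  haveI := Fact.mk hr
  have hk : k ≠ 0 := by rintro rfl; exact hrk (dvd_zero r)
  have hq1 : 1 < q := hq.one_lt
  have hqk1 : 1 < q ^ k := Nat.one_lt_pow hk hq1
  have hqk : q ^ k - 1 ≠ 0 := by omega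
  have hrq : ¬ r ∣ q := by
    intro h
    have h1 : r ∣ q ^ k := dvd_pow h hk
    have h2 : r ∣ q ^ k - 1 := (dvd_pow_self r two_ne_zero).trans hdvd
    have h3 : r ∣ q ^ k - (q ^ k - 1) := Nat.dvd_sub h1 h2
    have hle : 1 ≤ q ^ k := hqk1.le
    rw [Nat.sub_sub_self hle] at h3
    exact hr.one_lt.ne' (Nat.dvd_one.mp h3)
  have hr1 : ¬ r ∣ 1 := hr.not_dvd_one
  have key := Dioph.padicValNat_pow_sub_pow_le_fermat hr hr2 hrq hr1 hq1 k
  simp only [one_pow] at key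
  have hvk : padicValNat r k = 0 := padicValNat.eq_zero_of_not_dvd hrk
  have h2 : 2 ≤ padicValNat r (q ^ k - 1) := (padicValNat_dvd_iff_le hqk).mp hdvd
  have h3 : 2 ≤ padicValNat r (q ^ (r - 1) - 1) := by omega
  have h4 : r ^ 2 ∣ q ^ (r - 1) - 1 := (pow_dvd_pow r h3).trans pow_padicValNat_dvd
  have hle : 1 ≤ q ^ (r - 1) := Nat.one_le_pow _ _ hq.pos
  show q ^ (r - 1) ≡ 1 [MOD r ^ 2]
  exact ((Nat.modEq_iff_dvd' hle).mpr h4).symm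

/-- The `r ∤ k` square-divisor mass of `qᵏ − 1`: `Σ_{r ∤ k, r ∣ qᵏ−1} (ord_r(qᵏ−1) − 1)·log r`.
By `wieferichSupport` every prime with a nonzero term (and `r ≠ 2`) is a base-`q` Wieferich prime;
this is the ONLY part of the powerful defect of `qᵏ − 1` not controlled unconditionally. -/
noncomputable def wieferichMass (q k : ℕ) : ℝ :=
  ∑ r ∈ (q ^ k - 1).primeFactors with ¬ r ∣ k,
    (((q ^ k - 1).factorization r - 1 : ℕ) : ℝ) * Real.log r

/-- **Relative crux (provable now, unconditional; M-sized).** The powerful defect of `qᵏ − 1`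
carried by the primes dividing `k` is `≤ ε k log q + O_ε((log k)²)`: for `r ∣ k` with
`r ∣ qᵏ − 1` one has `ord_r(qᵏ−1) = ord_r(q^{d_r}−1) + ord_r(k)` with `d_r = ord of q mod r`,
`r·d_r ∣ k`, so `(ord_r(q^{d_r}−1) − 1) log r ≤ d_r log q ≤ (k/r) log q`; split at `r ≶ log₂k/ε`.
Hence `log(qᵏ − 1) ≤ log rad(qᵏ − 1) + ε k log q + C + wieferichMass q k`. -/
theorem relativeCrux (q : ℕ) (hq : q.Prime) (ε : ℝ) (hε : 0 < ε) :
    ∃ C : ℝ, ∀ k : ℕ, 1 ≤ k →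
      Real.log ((q ^ k - 1 : ℕ) : ℝ) ≤
        Real.log ((UniqueFactorizationMonoid.radical (q ^ k - 1) : ℕ) : ℝ) +
          ε * k * Real.log q + C + wieferichMass q k := by
  sorry

/-- Corollary shape: the crux at `q` is EQUIVALENT to `wieferichMass q k ≤ ε k log q + C_ε`
(⇐ from `relativeCrux`; ⇒ since `rad ≤ (qᵏ−1)/exp(wieferichMass)` up to the free part). -/
theorem primePowerRadicalAt_of_wieferichMass (q : ℕ) (hq : q.Prime)
    (h : ∀ ε : ℝ, 0 < ε → ∃ C : ℝ, ∀ k : ℕ, 1 ≤ k → wieferichMass q k ≤ ε * k * Real.log q + C) :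
    PrimePowerRadicalAt q := by
  sorry

/-- The value `Φ_d(q)` of the `d`-th cyclotomic polynomial at `q`, as a natural number. -/
noncomputable def cycloVal (q d : ℕ) : ℕ :=
  ((Polynomial.cyclotomic d ℤ).eval (q : ℤ)).natAbs

/-- **Transfer C⁺ (`CyclotomicRadical q`)**: cyclotomic values at `q` are radical-full up to
`q^{ε φ(d)}` (the factor `d` absorbs the single non-primitive prime `P(d) ∥ Φ_d(q)`):
`Φ_d(q) ≤ C · d · rad(Φ_d(q)) · q^{ε φ(d)}` for all `d ≥ 1`. Square prime divisors of the
primitive part of `Φ_d(q)` are base-`q` Wieferich primes `r ≡ 1 (mod d)` (`wieferichSupport`). -/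
def CyclotomicRadical (q : ℕ) : Prop :=
  ∀ ε : ℝ, 0 < ε → ∃ C : ℝ, 0 < C ∧ ∀ d : ℕ, 1 ≤ d →
    (cycloVal q d : ℝ) ≤ C * d * ((UniqueFactorizationMonoid.radical (cycloVal q d) : ℕ) : ℝ) *
      (q : ℝ) ^ (ε * (Nat.totient d : ℝ))

/-- **Transfer lemma (provable now, M-sized): C⁺(q) ⟹ crux at q.** Uses
`qᵏ − 1 = ∏_{d ∣ k} Φ_d(q)` (`Polynomial.prod_cyclotomic_eq_X_pow_sub_one`), `Σ_{d∣k} φ(d) = k`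
(`Nat.sum_totient`), `gcd(Φ_d(q), Φ_e(q)) ∣ P` for `d ≠ e` so
`log rad(qᵏ−1) ≥ Σ_{d∣k} log rad Φ_d(q) − τ(k) log k`, and `τ(k)·(log C + 2 log k) = o(k)`. -/
theorem primePowerRadicalAt_of_cyclotomicRadical (q : ℕ) (hq : q.Prime)
    (h : CyclotomicRadical q) : PrimePowerRadicalAt q := by
  sorry

end LTE

/-! ## Card `lte-wieferich-transfer`, refinement: the giant/small split of the Wieferich mass -/
namespace Split

/-- `NoGiantWieferich q θ`: a square prime divisor `r` of `qᵈ − 1` with `r ∤ d` (a base-`q`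
Wieferich prime, `LTE.wieferichSupport`) is never a GIANT divisor: `r ≤ C · q^{θ d}`.
Necessary for the crux (the crux gives it for every `θ > 0`); consistent with a world in which
every large prime is Wieferich (there `qᵈ − 1` would merely have to be `q^{o(d)}`-smooth), so it
does NOT by itself imply infinitely many non-Wieferich primes: WALL-FREE. -/
def NoGiantWieferich (q : ℕ) (θ : ℝ) : Prop :=
  ∃ C : ℝ, ∀ d r : ℕ, 1 ≤ d → r.Prime → ¬ r ∣ d → r ^ 2 ∣ q ^ d - 1 →
    (r : ℝ) ≤ C * (q : ℝ) ^ (θ * d)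

/-- `SmallWieferichMass q θ ε`: the `(ord − 1)`-weighted log-mass of the SMALL (`r ≤ q^{θd}`)
square prime divisors `r ∤ d` of `qᵈ − 1` is `≤ ε d log q + C`. Consistent with a world in which
every large prime is Wieferich but `Φ_d(q) = (giant primes)² × little`: WALL-FREE on its own. -/
def SmallWieferichMass (q : ℕ) (θ ε : ℝ) : Prop :=
  ∃ C : ℝ, ∀ d : ℕ, 1 ≤ d →
    (∑ r ∈ (q ^ d - 1).primeFactors with (¬ r ∣ d ∧ (r : ℝ) ≤ (q : ℝ) ^ (θ * d)),
      (((q ^ d - 1).factorization r - 1 : ℕ) : ℝ) * Real.log r) ≤ ε * d * Real.log q + C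

/-- **Split lemma (provable now from `LTE.relativeCrux`, M-sized).** The two wall-free halves
together give the crux at `q`: giants are absent beyond `C`, smalls have mass `≤ ε d log q + C`,
the primes of `k` are free. Only the CONJUNCTION crosses the non-Wieferich wall. -/
theorem primePowerRadicalAt_of_split (q : ℕ) (hq : q.Prime)
    (hG : ∀ θ : ℝ, 0 < θ → NoGiantWieferich q θ)
    (hS : ∀ ε : ℝ, 0 < ε → ∃ θ : ℝ, 0 < θ ∧ SmallWieferichMass q θ ε) :
    PrimePowerRadicalAt q := by
  sorry

end Split

/-! ## Card `ljunggren-parity-level-dial` -/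
namespace Parity

/-- **Wall lemma (provable now, M-sized): the crux at `q` forces infinitely many non-Wieferich
primes base `q`** (Silverman 1988's argument needs abc only on the family `(1, qᵏ−1, qᵏ)`:
squarefree part `s_k ≥ c·q^{k(1−ε)/(2(1+ε))} → ∞`, and a prime `p ∥ qᵏ − 1`, `p ∤ k`, is
non-Wieferich by LTE). Any line to the crux therefore contains a non-Wieferich-producing stub. -/
theorem infinite_nonWieferich_of_primePowerRadicalAt (q : ℕ) (hq : q.Prime)
    (h : PrimePowerRadicalAt q) : {p : ℕ | p.Prime ∧ ¬ IsWieferich q p}.Infinite := by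
  sorry

/-- **Ljunggren 1943** (Norsk Mat. Tidsskr. 25): the Nagell–Ljunggren equation with square exponent,
`(xⁿ − 1)/(x − 1) = y²` with `x ≥ 2`, `n ≥ 3`, has exactly the solutions `(x,n) = (3,5), (7,4)`
(`11² = 121`, `20² = 400`). Not in the tree: to be vendored as a named Literature fact; used as a
hypothesis here. -/
def Ljunggren1943 : Prop :=
  ∀ x n y : ℕ, 2 ≤ x → 3 ≤ n → x ^ n - 1 = (x - 1) * y ^ 2 → (x = 3 ∧ n = 5) ∨ (x = 7 ∧ n = 4)

/-- folklore: a natural number all of whose prime exponents are even is a square. -/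
theorem isSquare_of_even_factorization {n : ℕ} (hn : n ≠ 0)
    (h : ∀ p ∈ n.primeFactors, Even (n.factorization p)) : IsSquare n := by
  refine ⟨n.factorization.prod fun p k => p ^ (k / 2), ?_⟩
  rw [← Finsupp.prod_mul]
  conv_lhs => rw [← Nat.prod_factorization_pow_eq_self hn]
  apply Finsupp.prod_congr
  intro p hp
  rw [← pow_add]
  congr 1
  have := h p (by simpa using hp)
  obtain ⟨t, ht⟩ := this
  omega

/-- **Parity breach — PROVED (modulo the hypothesis `Ljunggren1943`; axioms propext/choice/Quot.sound;
apparently unrecorded).** For every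
`q ≥ 2` there are infinitely many primes `r` whose base-`q` Wieferich LEVEL `ord_r(q^{r−1} − 1)` is ODD.
Proof: for a prime `p ∤ q − 1`, `p ≥ 7`, every prime `r ∣ Φ_p(q) = (q^p−1)/(q−1)` has `ord_r(q) = p`,
so `r ≡ 1 (mod p)`, `r > p`, and `ord_r Φ_p(q) = ord_r(q^p − 1) =` (LTE, `r ∤ p`) the level of `r`;
`Φ_p(q)` is not a square (Ljunggren), so some `r` has odd level; distinct `p` give distinct `r`. -/
theorem oddLevel_infinite (hL : Ljunggren1943) (q : ℕ) (hq : 2 ≤ q) :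
    {r : ℕ | r.Prime ∧ Odd (padicValNat r (q ^ (r - 1) - 1))}.Infinite := by
  refine Set.infinite_of_forall_exists_gt fun N => ?_
  obtain ⟨p, hpge, hp⟩ := Nat.exists_infinite_primes (N + q + 7)
  have hpN : N < p := by omega
  have hqp : q < p := by omega
  have hp7 : 7 ≤ p := by omega
  have hp0 : p ≠ 0 := hp.ne_zero
  have hq1 : 1 ≤ q := by omega
  -- M = (q^p - 1)/(q - 1), (q - 1) * M = q^p - 1, M = Σ_{k<p} q^k
  have hdvd : q - 1 ∣ q ^ p - 1 := Nat.sub_one_dvd_pow_sub_one q p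
  set M := (q ^ p - 1) / (q - 1) with hM_def
  have hM : (q - 1) * M = q ^ p - 1 := Nat.mul_div_cancel' hdvd
  have hsum : ∑ k ∈ Finset.range p, q ^ k = M := Nat.geomSum_eq hq p
  have hqp1 : 1 < q ^ p := Nat.one_lt_pow hp0 (by omega)
  have hM0 : M ≠ 0 := by
    intro h; rw [h, mul_zero] at hM; omega
  -- M is not a square (Ljunggren 1943)
  have hnsq : ¬ IsSquare M := by
    rintro ⟨y, hy⟩
    have h := hL q p y hq (by omega) (by rw [← hM, hy]; ring)
    omega
  -- a prime r with odd exponent in M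
  obtain ⟨r, hrM, hrodd⟩ : ∃ r ∈ M.primeFactors, Odd (M.factorization r) := by
    by_contra h
    push_neg at h
    exact hnsq (isSquare_of_even_factorization hM0 fun r hr => Nat.not_odd_iff_even.mp (h r hr))
  have hr : r.Prime := Nat.prime_of_mem_primeFactors hrM
  have hrdM : r ∣ M := Nat.dvd_of_mem_primeFactors hrM
  haveI := Fact.mk hr
  have hrqp : r ∣ q ^ p - 1 := hrdM.trans ⟨q - 1, by rw [← hM, mul_comm]⟩
  -- M ≡ p [MOD q - 1]
  have hMmod : M ≡ p [MOD q - 1] := by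
    have hterm : ∀ k ∈ Finset.range p, q ^ k % (q - 1) = 1 % (q - 1) := by
      intro k _
      have := (Nat.modEq_sub hq1).pow k
      rwa [one_pow] at this
    show M % (q - 1) = p % (q - 1)
    rw [← hsum, Finset.sum_nat_mod, Finset.sum_congr rfl hterm, ← Finset.sum_nat_mod]
    simp
  -- r ∤ q - 1
  have hrq1 : ¬ r ∣ q - 1 := by
    intro hrq1
    have h1 : M ≡ p [MOD r] := hMmod.of_dvd hrq1
    have h2 : M ≡ 0 [MOD r] := Nat.modEq_zero_iff_dvd.mpr hrdM
    have h3 : p ≡ 0 [MOD r] := h1.symm.trans h2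
    have hrp : r ∣ p := Nat.modEq_zero_iff_dvd.mp h3
    have hrp' : r = p := (Nat.prime_dvd_prime_iff_eq hr hp).mp hrp
    have : p ≤ q - 1 := Nat.le_of_dvd (by omega) (hrp' ▸ hrq1)
    omega
  -- r ∤ q
  have hrq : ¬ r ∣ q := by
    intro h
    have h1 : r ∣ q ^ p := dvd_pow h hp0
    have h3 : r ∣ q ^ p - (q ^ p - 1) := Nat.dvd_sub h1 hrqp
    rw [Nat.sub_sub_self hqp1.le] at h3
    exact hr.one_lt.ne' (Nat.dvd_one.mp h3)
  -- the order of q mod r is p, hence p ∣ r - 1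
  have hq0 : (q : ZMod r) ≠ 0 := by
    rw [Ne, ZMod.natCast_eq_zero_iff]; exact hrq
  have hpow : (q : ZMod r) ^ p = 1 := by
    have h1 : ((q ^ p : ℕ) : ZMod r) = ((1 : ℕ) : ZMod r) := by
      rw [ZMod.natCast_eq_natCast_iff]
      exact ((Nat.modEq_iff_dvd' hqp1.le).mpr hrqp).symm
    simpa using h1
  have hord : orderOf (q : ZMod r) = p := by
    have hdp : orderOf (q : ZMod r) ∣ p := orderOf_dvd_of_pow_eq_one hpow
    rcases (Nat.dvd_prime hp).mp hdp with h1 | h1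
    · exfalso
      have hq1' : (q : ZMod r) = 1 := by
        have := pow_orderOf_eq_one (q : ZMod r)
        rwa [h1, pow_one] at this
      have hmod : q ≡ 1 [MOD r] := by
        have : ((q : ℕ) : ZMod r) = ((1 : ℕ) : ZMod r) := by simpa using hq1'
        exact (ZMod.natCast_eq_natCast_iff _ _ _).mp this
      exact hrq1 ((Nat.modEq_iff_dvd' hq1).mp hmod.symm)
    · exact h1
  have hpr : p ∣ r - 1 := by
    rw [← hord]
    exact orderOf_dvd_of_pow_eq_one (ZMod.pow_card_sub_one_eq_one hq0)
  have hpr' : p < r := by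
    have : p ≤ r - 1 := Nat.le_of_dvd (by have := hr.two_le; omega) hpr
    omega
  refine ⟨r, ⟨hr, ?_⟩, lt_trans hpN hpr'⟩
  -- level of r = exponent of r in M
  have hr2 : r ≠ 2 := by
    rintro rfl
    have : p ≤ 1 := Nat.le_of_dvd one_pos hpr
    omega
  have hrodd' : Odd r := hr.odd_of_ne_two hr2
  obtain ⟨m, hm⟩ := hpr
  have hm0 : m ≠ 0 := by
    rintro rfl
    have := hr.two_le
    omega
  -- v_r(q^(r-1) - 1) = v_r((q^p)^m - 1) = v_r(q^p - 1) + v_r(m)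
  have hqp0 : ¬ r ∣ q ^ p := fun h => hrq (hr.dvd_of_dvd_pow h)
  have hLTE := padicValNat.pow_sub_pow hrodd' hqp1 (by simpa using hrqp) hqp0 hm0 (x := q ^ p) (y := 1)
  have hvm : padicValNat r m = 0 := by
    refine padicValNat.eq_zero_of_not_dvd fun h => ?_
    have hle : r ≤ m := Nat.le_of_dvd (Nat.pos_of_ne_zero hm0) h
    have h7 : 7 * m ≤ p * m := Nat.mul_le_mul_right m hp7
    have := hr.two_le
    omega
  have hkey : padicValNat r (q ^ (r - 1) - 1) = padicValNat r (q ^ p - 1) := by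
    rw [hm, pow_mul]
    simpa [hvm] using hLTE
  -- v_r(q^p - 1) = v_r((q-1) * M) = v_r(M)
  have hv1 : padicValNat r (q - 1) = 0 := padicValNat.eq_zero_of_not_dvd hrq1
  have hkey2 : padicValNat r (q ^ p - 1) = padicValNat r M := by
    rw [← hM, padicValNat.mul (by omega) hM0, hv1, zero_add]
  rw [hkey, hkey2, ← Nat.factorization_def M hr]
  exact hrodd

/-- **The wall becomes a dial — PROVED (modulo the hypothesis `Ljunggren1943`).**
Finitely many primes of level `≥ 3` (`q^{r−1} ≡ 1 mod r³`, heuristically a convergent Borel–Cantelli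
event, `Σ 1/r² < ∞`) already forces infinitely many NON-Wieferich primes base `q`: the odd levels of
`oddLevel_infinite` are eventually `= 1`. So the non-Wieferich-producing stub that every line to the
crux must contain (`infinite_nonWieferich_of_primePowerRadicalAt`) is discharged by a statement about
the `r`-adic SIZE of the single number `log_r q` — a transcendence measure, where the record is
Stewart 2013 (`Dioph.stewart2013_thm2.wieferichOrder`: level `< r^{1−1/(52 log log r)}·log q`). -/
theorem infinite_nonWieferich_of_finite_levelThree (hL : Ljunggren1943) (q : ℕ) (hq : q.Prime)
    (hfin : {r : ℕ | r.Prime ∧ q ^ (r - 1) ≡ 1 [MOD r ^ 3]}.Finite) :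
    {p : ℕ | p.Prime ∧ ¬ IsWieferich q p}.Infinite := by
  -- PROVED modulo `oddLevel_infinite`: odd level ∧ level < 3 ⟹ level = 1 ⟹ non-Wieferich.
  have hodd := oddLevel_infinite hL q hq.two_le
  refine (hodd.diff hfin).mono ?_
  rintro r ⟨⟨hr, hv⟩, hr3⟩
  refine ⟨hr, fun hW => hr3 ⟨hr, ?_⟩⟩
  haveI := Fact.mk hr
  have hne : q ^ (r - 1) - 1 ≠ 0 := by
    intro h0
    rw [h0, padicValNat.zero] at hv
    exact (Nat.not_odd_iff_even.mpr (by decide : Even 0)) hv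
  have hle : 1 ≤ q ^ (r - 1) := Nat.one_le_pow _ _ hq.pos
  have h2 : r ^ 2 ∣ q ^ (r - 1) - 1 := (Nat.modEq_iff_dvd' hle).mp hW.symm
  have hv2 : 2 ≤ padicValNat r (q ^ (r - 1) - 1) := (padicValNat_dvd_iff_le hne).mp h2
  have hv3 : 3 ≤ padicValNat r (q ^ (r - 1) - 1) := by
    rcases hv with ⟨m, hm⟩
    omega
  have h3 : r ^ 3 ∣ q ^ (r - 1) - 1 := (pow_dvd_pow r hv3).trans pow_padicValNat_dvd
  exact ((Nat.modEq_iff_dvd' hle).mpr h3).symm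

/-- **Level ladder (provable now, S-sized): finitely many primes of Wieferich LEVEL `≥ W`
(`q^{r−1} ≡ 1 mod r^W`) gives the wall-free exponential rung `rad(qᵏ − 1) ≫_δ q^{(1/(W−1) − δ)k}`**
— by LTE every `r ∣ qᵏ − 1` beyond the finitely many has `ord_r(qᵏ−1) ≤ (W−1) + ord_r(k)`.
`W = 2` is the crux itself; `W = 3` already beats every known bound (record: `log rad(qᵏ−1) ≫
(log k)²/log log k`, Stewart–Yu/Pasten) yet is heuristically TRUE with room (`Σ 1/r² < ∞`). -/
theorem rung_of_finite_high_level (q : ℕ) (hq : q.Prime) (W : ℕ) (hW : 3 ≤ W)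
    (hfin : {r : ℕ | r.Prime ∧ q ^ (r - 1) ≡ 1 [MOD r ^ W]}.Finite) :
    ∀ δ : ℝ, 0 < δ → ∃ C : ℝ, 0 < C ∧ ∀ k : ℕ, 1 ≤ k →
      ((q ^ k : ℕ) : ℝ) ≤ C * ((UniqueFactorizationMonoid.radical (q ^ k - 1) : ℕ) : ℝ) ^ ((W : ℝ) - 1 + δ) := by
  sorry

end Parity

end Summit.ABC.ABC.Cruxes.PrimePowerRadical.Sketch
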